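import Mathlib
import HarnessLib
import HarnessLib.Audit
import Summits.SmoothPoincare4.Statement
import Literature.Topology.FourManifolds.ConnectedSum
import Literature.Geometry.Kaehler.ManifoldForms
import HarnessLib.Audit.Status.Attr

/-!
Route: EllipticRuledHost

DORMANT since 2026-08-22T17:51:18Z (reconciler: no traction for 5.5 d (last activity item-evidence-added at 2026-08-17T04:21:45Z); parked, not closed — `ledger route dormant route-SmoothPoincare4-EllipticRuledHost --off` to reactivate) — unstaffed, not closed; items shared with open routes are served there. `ledger route dormant <id> --off` reactivates.

# Route EllipticRuledHost — the elliptic ruled surface remembers — symplectic forms on Σ#(S²×T²)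
make Σ invertible, positive ones make Σ ≅ S⁴

It suffices to show X = HostPositive (card elliptic-ruled-host-remembers, spine and only card; X =
K1 ∧ K2 of the card, filed per Σ):
for every smooth homotopy 4-sphere Σ — literally the binders of the Statement: a Hausdorff,
second-countable C^∞ 4-manifold M
(`ChartedSpace (EuclideanSpace ℝ (Fin 4)) M`, `IsManifold (𝓡 4) ∞ M`) with a homotopy equivalence `M
≃ₕ 𝕊⁴`; compactness
(Hatcher Prop. 3.29, tree theorem `compactSpace_of_homotopyEquiv_sphere_four_holds`) and
orientability are CONSEQUENCES the
provers may invoke, deliberately not hypotheses, so that no HomotopySphere / cobordism / Θ₄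
vocabulary enters the route
(rev 1, cone repair) — SOME closed connected sum P = Σ # H with the ELLIPTIC RULED SURFACE H = S²×T²
= 𝕊²×(𝕊¹×𝕊¹)
(product model (𝓡 2).prod((𝓡 1).prod(𝓡 1)); P on 𝓡 4; the Kervaire–Milnor gluing data i₁, i₂, jA, jB
of
`Literature.Topology.FourManifolds.IsConnectedSum` written out so that the summand's fibre sphere F
= 𝕊²×{t₀} and section
torus T = {s₀}×𝕋², both off the disc centre i₂ 0, can be named inside P) carries a symplectic form
sf (smooth, closed,
pointwise nondegenerate `Literature.Geometry.Kaehler.MForm (𝓡 4) P ℝ 2`) for which jB(F) and jB(T)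
are symplectic
surfaces, sf-orthogonal at their single crossing jB(s₀,t₀). The recogniser CappingRecogniser (crux
2: McDuff's ruling by
J-spheres with jB(T) a J-section, then Laudenbach–Poénaru) turns X(Σ) into Σ ≅ 𝕊⁴; the weaker K1 =
HostSymplectic (ANY
symplectic form on some Σ # H) already makes Σ invertible (RuledRecogniser + UnitLemma: Li's
smooth-sphere recogniser and
the covering swindle S²×ℝ² = ℝ⁴ ∖ line ⊂ ℝ⁴), i.e. proves crux (A) of route SchoenfliesSplit. (Lean
below: scope-free
spelling, `(⊤ : ℕ∞)` = the exponent `∞`.)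
Lean: `∀ (M : Type) [TopologicalSpace M] [T2Space M] [SecondCountableTopology M] [ChartedSpace
(EuclideanSpace ℝ (Fin 4)) M] [IsManifold (𝓡 4) (⊤ : ℕ∞) M], ContinuousMap.HomotopyEquiv M
(Metric.sphere (0 : EuclideanSpace ℝ (Fin 5)) 1) → ∃ (P : Type) (_ : TopologicalSpace P) (_ :
T2Space P) (_ : SecondCountableTopology P) (_ : ChartedSpace (EuclideanSpace ℝ (Fin 4)) P) (_ :
IsManifold (𝓡 4) (⊤ : ℕ∞) P) (_ : CompactSpace P) (i₁ : EuclideanSpace ℝ (Fin 4) → M) (i₂ :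
EuclideanSpace ℝ (Fin 4) → (↥(Metric.sphere (0 : EuclideanSpace ℝ (Fin 3)) 1) × (↥(Metric.sphere (0
: EuclideanSpace ℝ (Fin 2)) 1) × ↥(Metric.sphere (0 : EuclideanSpace ℝ (Fin 2)) 1)))) (jA :
↥(Literature.Topology.FourManifolds.puncture i₁) → P) (jB :
↥(Literature.Topology.FourManifolds.puncture i₂) → P) (s₀ : ↥(Metric.sphere (0 : EuclideanSpace ℝ
(Fin 3)) 1)) (t₀ : (↥(Metric.sphere (0 : EuclideanSpace ℝ (Fin 2)) 1) × ↥(Metric.sphere (0 :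
EuclideanSpace ℝ (Fin 2)) 1))) (hF : ∀ s : ↥(Metric.sphere (0 : EuclideanSpace ℝ (Fin 3)) 1), (s,
t₀) ∈ Literature.Topology.FourManifolds.puncture i₂) (hT : ∀ t : (↥(Metric.sphere (0 :
EuclideanSpace ℝ (Fin 2)) 1) × ↥(Metric.sphere (0 : EuclideanSpace ℝ (Fin 2)) 1)), (s₀, t) ∈
Literature.Topology.FourManifolds.puncture i₂) (sf : Literature.Geometry.Kaehler.MForm (𝓡 4) P ℝ 2),
Manifold.IsSmoothEmbedding 𝓘(ℝ, EuclideanSpace ℝ (Fin 4)) (𝓡 4) (⊤ : ℕ∞) i₁ ∧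
Manifold.IsSmoothEmbedding 𝓘(ℝ, EuclideanSpace ℝ (Fin 4)) ((𝓡 2).prod ((𝓡 1).prod (𝓡 1))) (⊤ : ℕ∞)
i₂ ∧ Manifold.IsSmoothEmbedding (𝓡 4) (𝓡 4) (⊤ : ℕ∞) jA ∧ IsOpen (Set.range jA) ∧
Manifold.IsSmoothEmbedding ((𝓡 2).prod ((𝓡 1).prod (𝓡 1))) (𝓡 4) (⊤ : ℕ∞) jB ∧ IsOpen (Set.range jB)
∧ Set.range jA ∪ Set.range jB = Set.univ ∧ (∀ a b, jA a = jB b ↔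
Literature.Topology.FourManifolds.connectedSumRel i₁ i₂ a b) ∧
Literature.Geometry.Kaehler.IsSmoothForm sf ∧ Literature.Geometry.Kaehler.IsClosedForm sf ∧ (∀ (x :
P) (v : TangentSpace (𝓡 4) x), v ≠ 0 → ∃ w : TangentSpace (𝓡 4) x, sf x ![v, w] ≠ 0) ∧ (∀ s :
↥(Metric.sphere (0 : EuclideanSpace ℝ (Fin 3)) 1), ∃ a b : TangentSpace (𝓡 2) s, sf (jB ⟨(s, t₀), hF
s⟩) ![mfderiv (𝓡 2) (𝓡 4) (fun s' : ↥(Metric.sphere (0 : EuclideanSpace ℝ (Fin 3)) 1) => jB ⟨(s',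
t₀), hF s'⟩) s a, mfderiv (𝓡 2) (𝓡 4) (fun s' : ↥(Metric.sphere (0 : EuclideanSpace ℝ (Fin 3)) 1) =>
jB ⟨(s', t₀), hF s'⟩) s b] ≠ 0) ∧ (∀ t : (↥(Metric.sphere (0 : EuclideanSpace ℝ (Fin 2)) 1) ×
↥(Metric.sphere (0 : EuclideanSpace ℝ (Fin 2)) 1)), ∃ a b : TangentSpace ((𝓡 1).prod (𝓡 1)) t, sf
(jB ⟨(s₀, t), hT t⟩) ![mfderiv ((𝓡 1).prod (𝓡 1)) (𝓡 4) (fun t' : (↥(Metric.sphere (0 :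
EuclideanSpace ℝ (Fin 2)) 1) × ↥(Metric.sphere (0 : EuclideanSpace ℝ (Fin 2)) 1)) => jB ⟨(s₀, t'),
hT t'⟩) t a, mfderiv ((𝓡 1).prod (𝓡 1)) (𝓡 4) (fun t' : (↥(Metric.sphere (0 : EuclideanSpace ℝ (Fin
2)) 1) × ↥(Metric.sphere (0 : EuclideanSpace ℝ (Fin 2)) 1)) => jB ⟨(s₀, t'), hT t'⟩) t b] ≠ 0) ∧ (∀
(a : TangentSpace (𝓡 2) s₀) (b : TangentSpace ((𝓡 1).prod (𝓡 1)) t₀), sf (jB ⟨(s₀, t₀), hF s₀⟩)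
![mfderiv (𝓡 2) (𝓡 4) (fun s' : ↥(Metric.sphere (0 : EuclideanSpace ℝ (Fin 3)) 1) => jB ⟨(s', t₀),
hF s'⟩) s₀ a, mfderiv ((𝓡 1).prod (𝓡 1)) (𝓡 4) (fun t' : (↥(Metric.sphere (0 : EuclideanSpace ℝ (Fin
2)) 1) × ↥(Metric.sphere (0 : EuclideanSpace ℝ (Fin 2)) 1)) => jB ⟨(s₀, t'), hT t'⟩) t₀ b] = 0)`

## Assembly
Pure logic, no Literature lemma at all (rev 1): the Statement hands over M with its atlas and e : M
≃ₕ 𝕊⁴, exactly the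
binders every item quantifies over, so `theorem closes (hX : HostPositive) (hCap :
CappingRecogniser) : SmoothPoincare4 :=
by intro M _ _ _ _ _ e; exact hCap M e (hX M e)` (axioms propext, Classical.choice, Quot.sound;
certified by
`#h21_check_closes` in the planner's Sketch.lean). Secondary chain (all items of this route):
HostSymplectic →
RuledRecogniser → HostAbsorbed (AbsorbedOfSymplectic) → every punctured Σ embeds in ℝ⁴ (UnitLemma,
granted π₁(Σ ∖ p) = 1
and puncture homogeneity, the content of support items 8099/8100 of CartanHadamardSwindle restated
over the same binders)
= crux (A) of SchoenfliesSplit.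

Rationale: WHY THIS LINE. HOST LADDER: "Σ # M admits a symplectic form" pays dissolution for M = ℂP²
(Taubes/Gromov), one-stabilisation for M = S²×S² (McDuff's
Theorem E, Wendl2018), and here, for the one host that is at once Kodaira-dimension −∞ RIGID (b⁺ =
1: a closed symplectic 4-manifold with
a smoothly embedded essential square-0 sphere is rational or ruled, Li1999 / LiLiu1995 / McDuff1990)
and infinite-π₁ SWINDLE-ABLE
(universal cover S²×ℝ² ⊂ ℝ⁴), it pays INVERTIBILITY of Σ from any form at all, and Σ ≅ S⁴ from one
form positive on fibre ∪ section,
because the complement of fibre ∪ section is the 1-handlebody D²×T₀ = ♮2(S¹×B³) over whose boundary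
every diffeomorphism extends
(LaudenbachPoenaru1972) — no Schoenflies ball, no Gromov recognition of ℝ⁴ (route SymplecticCap), no
Cerf. Imported: pseudoholomorphic
curve theory of ruled surfaces (McDuff1990, Wendl2018 Thm D/E, McDuffSalamon2017 §4.1(v)–(vi)), b⁺ =
1 Seiberg–Witten wall-crossing
inside Li's recogniser (LiLiu1995, Taubes1994), classical handlebody topology
(LaudenbachPoenaru1972), covering-space swindles
(Mazur1959). Every known obstruction to K1 vanishes: [ω]² > 0 is available (P ≃ S²×T²) and gauge
invariants cannot see the summand
(`Literature.Barriers.SmoothPoincare4.GaugeSumBarrierFour`, KotschickMorganTaubes1995), so ¬K1 for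
one Σ would be the first
non-symplectic 4-manifold invisible to cohomology + Seiberg–Witten — informative either way. What no
prior route does: Stabilisation
(S²×S² host) needs a cancellation crux equivalent to SPC4-for-1-stably-standard spheres and its k =
1 crux is incomparable with K1 (the
light-bulb shortcut from one to the other fails: Schneiderman–Teichner arXiv:1904.12350 Rem. 1.2);
CartanHadamardSwindle uses
aspherical hosts with a curvature recogniser and still needs Schoenflies; OneHandleSplitting (S¹×S³
host) needs Perelman and
Budney–Gabai; SymplecticCap works on the punctured Σ with Gromov's relative recognition (XL, partly
unprinted). Negatives index: no
refuted statement of this summit concerns symplectic forms on hosts (checked `ledger negatives` when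
reachable: empty for SPC4 per the
card's filing; gate intermittently unreachable this session).

RANKED CRUXES. #0 HostPositive (target) — X: for every homotopy 4-sphere Σ some closed connected sum
P = Σ # (𝕊²×(𝕊¹×𝕊¹)), given with its gluing data (i₁, i₂, jA, jB) and base points s₀, t₀ off the
disc centre, carries a symplectic form for which the summand's fibre sphere jB(𝕊²×{t₀}) and section
torus jB({s₀}×𝕋²) are symplectic surfaces, sf-orthogonal at their crossing (card K1 ∧ K2). (why it
might fail: X ⟺ SPC4 given CappingRecogniser (S⁴ itself: P = S²×T² with the product form), so X is
false iff an exotic 4-sphere exists; constructively it inherits K1's missing engine AND K2's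
dual-torus unknotting problem.) [McDuff1990, Wendl2018, LaudenbachPoenaru1972, Li1999,
GompfStipsicz1999]
#2 CappingRecogniser (crux) — CAPPING RECOGNISER (card P2, the named-fact-level step the deciding
theorem consumes, filed first per the cone rule): if a closed P = Σ # H with gluing data as in X
carries a symplectic form making jB(F), jB(T) symplectic and sf-orthogonal at the crossing, then Σ ≅
𝕊⁴. Proof in print-sized steps: one sf-tame J makes both surfaces J-holomorphic; π₂(P) = ℤ·[F]
forbids bubbling in class [F] for EVERY tame J, so automatic transversality + positivity of
intersections foliate P by embedded J-spheres with jB(F) a leaf (McDuff1990; Wendl2018 Thm D(1),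
§1.3.2); the J-torus meets each leaf once, so it is a section and the base is T²; even intersection
form ⇒ trivial bundle; the complement of ν(fibre ∪ any section) in S²×T² is a D²-bundle over T₀ = T²
∖ D², i.e. D²×T₀ = ♮2(S¹×B³), while in P it is (D²×T₀) # Σ; so (♮2 S¹×B³) # Σ ≅ ♮2(S¹×B³), and since
every diffeomorphism of #2(S¹×S²) extends over ♮2(S¹×B³) (Laudenbach–Poénaru), Σ = ((♮2 S¹×B³) # Σ)
∪ ♮2(S²×D²) ≅ S⁴. [difficulty: XL] (why it might fail: True at theorem level but unprinted as
stated: needs one tame J with BOTH surfaces holomorphic (hence the orthogonal crossing), no bubbling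
in class F, automatic transversality, trivial bundle from the even form, D²×T₀ complement for every
section degree, then LP; Lean has no J-curves at all (XL).) [McDuff1990, Wendl2018,
McDuffSalamon2017, LaudenbachPoenaru1972, McDuff1991LocalBehaviour]
#3 HostSymplectic (crux) — K1 (card K1, the whole bet): for every homotopy 4-sphere Σ some closed
connected sum P = Σ # (𝕊²×(𝕊¹×𝕊¹)) (relational `IsConnectedSum`, P on 𝓡 4) admits a symplectic form
— a smooth closed pointwise-nondegenerate 2-form. Equivalent, given RuledRecogniser, to "S²×T²
absorbs Σ" (HostAbsorbed); implies that Σ is invertible (UnitLemma). [difficulty: open-problem] (why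
it might fail: No engine makes ω on Σ#(S²×T²) from Σ ≃ S⁴ alone: pencils/BLF simplification need
handle data of Σ, near-symplectic forms stop at one odd zero-circle (Perutz2006 Thm 1.4, 1.8: #even
≡ 1−b₁+b⁺ = 0), and ω exists iff S²×T² absorbs Σ, so any non-invertible Σ refutes it.) [Li1999,
Taubes1994, Perutz2006, Baykur2008, GompfStipsicz1999, KotschickMorganTaubes1995,
FreedmanGompfMorrisonWalker2010]
#4 PositivityUpgrade (crux) — K2 (card K2), per Σ: if some connected sum Σ # (𝕊²×(𝕊¹×𝕊¹)) admits a
symplectic form, then some connected sum with gluing data admits one for which the summand's fibre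
sphere and section torus are symplectic and sf-orthogonal at the crossing (the body of X for that
Σ). Given K1 and RuledRecogniser, P ≅ S²×T² and K2 asks that the summand pair (jB F, jB T) be
carried to (fibre, section) by a diffeomorphism — a light-bulb statement for a sphere whose only
dual is a TORUS. [deps: HostSymplectic] [difficulty: open-problem] (why it might fail: With P ≅
S²×T² it says the summand pair (F,T) is smoothly standard: unknotting a sphere with only a dual
TORUS (complement group F₂, not Freedman-good; LBT needs a COMMON dual sphere, ST arXiv:1904.12350
Rem 1.2) is open even topologically; F#(2-knot) shows complement data matter.) [Gabai2020,
arXiv:1904.12350, BudneyGabai2019, FreedmanQuinn1990, Gluck1962]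
#5 RuledRecogniser (crux) — LI–McDUFF RECOGNISER specialised to the host (card P1, first half; a
named fact not yet in Literature, hence a crux): every CLOSED connected sum P = Σ # (𝕊²×(𝕊¹×𝕊¹)) of
a homotopy 4-sphere that admits a symplectic form is diffeomorphic to 𝕊²×(𝕊¹×𝕊¹). Reason: P contains
the smoothly embedded sphere jB(F) with trivial normal bundle and a dual torus, hence essential of
square 0; b₂(P) = 2, σ = 0, b⁺ = 1; Li 1999 Thm 1 (via Li–Liu's b⁺ = 1 wall-crossing / McDuff) makes
(P, ω) rational or ruled up to diffeomorphism, and π₁ = ℤ², b₂ = 2, even form single out the trivial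
S²-bundle over T². [difficulty: XL] (why it might fail: Rests on Li1999 Thm 1 (smoothly embedded
ESSENTIAL sphere, square ≥ 0 ⇒ rational/ruled), text unread (acq-03619): if only S·S > 0 were
covered the square-0, b⁺ = 1 case must be re-derived from LiLiu1995/McDuff1990; the diffeo-type step
needs the even form of P (Σ° is a homology ball).) [Li1999, LiLiu1995, McDuff1990, Wendl2018]
#9 HostAbsorbed (support) — S²×T² ABSORBS EVERY HOMOTOPY 4-SPHERE: for every Σ some closed connected
sum P = Σ # (𝕊²×(𝕊¹×𝕊¹)) is diffeomorphic to 𝕊²×(𝕊¹×𝕊¹). The smooth content of K1 (= HostSymplectic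
∧ RuledRecogniser, item AbsorbedOfSymplectic; conversely pull back the product form); strictly
between SPC4 and invertibility; incomparable, as far as searched, with StabOneSuffices of route
Stabilisation (S²×S² host). Other doors: P fibres over S¹ (a nowhere-zero closed 1-form; fibre has
π₁ = ℤ hence is S²×S¹, monodromy forced by the even form), or P admits a complex structure (b₁ even
⇒ Kähler). [difficulty: open-problem] [Li1999, Wall1964, Kang2022OneStabilization, Gluck1962]
#9 AbsorbedOfSymplectic (support) — K1 and the recogniser give absorption: HostSymplectic →
RuledRecogniser → HostAbsorbed (pure logic; compiled in the planner's Sketch.lean). [difficulty: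
provable-now] [Li1999, McDuff1990]
#9 UnitLemma (support) — THE COVERING SWINDLE FOR THE RULED HOST (card P1, second half): granted the
two known facts carried as its first hypotheses — every punctured homotopy 4-sphere is simply
connected (π₁(S⁴) = 1, tree `simplyConnectedSpace_sphere_four`; = support item
stmt-SmoothPoincare4-8099 of CartanHadamardSwindle) and puncture homogeneity (one punctured
embedding in ℝ⁴ gives one at every point; = stmt-SmoothPoincare4-8100, the tree's disc-theorem
family) — if S²×T² absorbs every homotopy 4-sphere then every punctured homotopy 4-sphere smoothly
embeds in ℝ⁴; the conclusion is crux (A) `SchsplitPuncturedEmbeds` of route SchoenfliesSplit up to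
unfolding the notation `∞` (so K1 feeds that route's frame (A) ∧ Schoenflies → SPC4). Proof: the
universal cover of 𝕊²×(𝕊¹×𝕊¹) is the open subset E = ℝ⁴ ∖ {x₀ = x₁ = x₂ = 0} ≅ S²×ℝ² of ℝ⁴ with the
explicit smooth covering x ↦ (x'/‖x'‖, (cos log‖x'‖, sin log‖x'‖), (cos x₃, sin x₃)), x' =
(x₀,x₁,x₂); compose with the diffeomorphism P ≅ H; the punctured summand Σ ∖ {i₁ 0} is an open,
simply connected (hypothesis), locally path-connected subset of P, so its inclusion lifts through
the covering (Mathlib `IsCoveringMap` lifting criterion) to a smooth embedding into E ⊂ ℝ⁴;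
homogeneity moves the puncture. [difficulty: L] [Hatcher2002, Mazur1959, KervaireMilnor1963]
#9 TargetSplit (support) — the card's split of X: HostSymplectic → PositivityUpgrade → HostPositive
(pure logic, `fun h₁ h₂ S => h₂ S (h₁ S)`, compiled in Sketch.lean). [difficulty: provable-now]
[McDuff1990]

TWO-LAYER PLAN. Foreseen glued splits (none filed now; k ≤ 3, depth 1): CappingRecogniser ⇐
McDuffSectionRuling (the J-curve fact: marked symplectic
host sum ⇒ diffeomorphism of triples (P, jB F, jB T) ≅ (S²×T², fibre, section)) → LPCapping ((D²×T₀)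
# Σ ≅ D²×T₀ ⇒ Σ ≅ S⁴, smooth
topology only) → CappingRecogniser. HostSymplectic ⇐ OneOddCircle (Σ # H carries a near-symplectic
form with exactly one, odd, zero
circle — Honda/Perutz2006, b⁺ = 1) → LastCircle (removal criterion for a single odd circle on a
manifold with the Betti numbers of S²×T²)
→ HostSymplectic; alternative door HostAbsorbed ⇐ FibresOverCircle (Σ # H admits a nowhere-zero
closed 1-form) → MappingTorusRigidity
(a closed 4-manifold fibred over S¹ with π₁ = ℤ², π₂ = ℤ and even form is S²×T²; fibre S²×S¹ by
prime decomposition + Perelman,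
monodromy in Gluck's π₀Diff(S²×S¹) forced by the form). PositivityUpgrade ⇐ DualTorusLightBulb (in
S²×T², an embedded sphere meeting
{s₀}×T² transversally once, homologous to the fibre, whose complement together with the torus has
free π₁ of rank 2, is isotopic rel the
torus to a fibre) → PositivityUpgrade. RuledRecogniser ⇐ Li1999 as a vendored Literature fact →
restatement `(h : fact) → RuledRecogniser`.

KILL CRITERIA. ¬HostSymplectic for a single Σ (a non-symplectic Σ # S²×T²) closes the route
`refuted:HostSymplectic` — and is a landmark by itself
(an exotic, non-invertible 4-sphere, or the first SW-invisible non-symplectic 4-manifold).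
¬PositivityUpgrade with HostSymplectic intact ⇒
pivot: the route shrinks to its UNIT chain (K1 → HostAbsorbed → UnitLemma → SchoenfliesSplit crux A)
and is closed `superseded` by
SchoenfliesSplit once that chain's items are proved. ¬CappingRecogniser or ¬RuledRecogniser can only
be mis-transcription (class
misstated) ⇒ repaired item `…R`, same glue. SPC4 proved elsewhere moots everything; HostAbsorbed
proved by other means (fibering,
complex structures) moots K1 but not the route; Schoenflies proved elsewhere upgrades the unit chain
to a full proof given K1 alone.

NOT DECOMPOSED YET. The J-holomorphic package inside CappingRecogniser (tame J through two
orthogonal symplectic surfaces, compactness from π₂(P) = ℤ·F,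
automatic transversality, positivity of intersections, classification of S²-bundles over T² by the
parity of the form), the b⁺ = 1
wall-crossing inside RuledRecogniser, the explicit universal cover and the lifting/embedding
bookkeeping inside UnitLemma, Hausdorffness /
second countability / compactness of Kervaire–Milnor sums (demanded of the ∃-witness P, supplied by
`exists_isConnectedSum`), and every
orientation convention (S²×T², D²×T₀ and ♮2(S¹×B³) admit orientation-reversing diffeomorphisms, so
the orientation-free `IsConnectedSum`
costs nothing). All are layer-2 children or prover-side `--supports` lemmas.

CHEAPEST FALSIFIER. (i) Lookup, pending acq-03619: the exact hypothesis of Li1999 Thm 1 — if "square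
≥ 0, essential, SMOOTHLY embedded" is right,
RuledRecogniser is a citation; if not, it needs the b⁺ = 1 argument from LiLiu1995 (repairable, not
fatal). (ii) Non-vacuity, checked by
hand: S⁴ satisfies X (P = S²×T² = S⁴ # S²×T² by `isConnectedSum_sphere_self`, product area forms, F
⊥ T). (iii) The one computation
that would kill the MECHANISM: a closed smooth 4-manifold homeomorphic to S²×T², containing a
smoothly embedded essential square-0 sphere,
known to be non-symplectic — none exists in the literature searched (it would contradict nothing
known and would itself be new). (iv) For
K2: a smoothly knotted fibre-class sphere in S²×T² dual to {s₀}×T² with free complement group — none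
known.

NUMBERS. Σ # S²×T²: χ = 0, σ = 0, b₁ = 2, b₂ = 2, b⁺ = 1, π₁ = ℤ², π₂ = ℤ·[F] (Σ° is contractible
rel nothing: a homology ball with π₁ = 1),
intersection form hyperbolic (even), K² = 2χ + 3σ = 0, χ_h = 0; near-symplectic parity 1 − b₁ + b⁺ =
0 (Perutz2006 Thm 1.8: an even
number of even zero-circles; one odd circle is the least non-symplectic configuration, Thm 1.4); a
genus-g Lefschetz fibration over S² on
it would need exactly 4g − 4 singular fibres (χ count), g = 1 meaning an honest T²-bundle, i.e. the
conclusion. Items at open: 10 (1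
target, 4 cruxes, 4 support, 1 assembly).

DEFINITION REQUESTS. None required: HomotopySphere, IsConnectedSum / puncture / connectedSumRel,
MForm / IsSmoothForm / IsClosedForm, mfderiv exist and all
10 items elaborate (Sketch.lean / Sketch2.lean rc 0; signatures are written scope-free: `(⊤ : ℕ∞)`
for the smoothness exponent, `Diffeomorph … (⊤ : ℕ∞)` for `≃ₘ⟮…⟯`). Convenience (not filed): a
packaging predicate `IsMarkedSymplecticHostSum S P i₁ i₂ jA jB s₀ t₀ sf`
under Literature/Geometry/Symplectic would shrink HostPositive / CappingRecogniser /
PositivityUpgrade from ~3 kB each to one line; cite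
facts wanted later for the recogniser cruxes: Li1999 Thm 1 (acq-03619 open), McDuff1990 Thm 1.1 =
Wendl2018 Thm D(1), LaudenbachPoenaru1972.

Novelty: Searches (2026-08-15): `lit search "Li smoothly embedded spheres in symplectic 4-manifolds rational
ruled"` (searchd rc 75, unavailable all
session); `lit galaxy search "smoothly embedded essential sphere" --star all` (0 hits), `"essential
sphere of nonnegative self-intersection"
--star all` (0), `lit galaxy read pdf:5364346412926195440 --grep '[18]'` (Dorfmeister–Li JSG 2010
citing Li1999 only for minimality);
`lit read book:wendlnd-holomorphic-curves-low-dimensions --grep ruled` (92 hits; Thm A, D, E pp.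
20–21, §1.3.2 p. 26 read);
`lit read book:mcduff2017-introduction-symplectic-topology` pp. 191–192 (§4.1 (v),(vi) read); `lit
read arxiv:1705.09989 --grep common`
(Gabai Thm 1.2/1.9/10.x: common transverse sphere throughout); `lit read arxiv:1904.12350` p. 3 (ST
Thm 1.1, Rem 1.2 read: the dual must be
COMMON — kills the light-bulb shortcut StabOneSuffices ⇒ K1); `lit read arxiv:math/0601320` (Perutz
Thm 1.4, 1.8 read); 47 route files
of the sub scanned by title + the four nearest (Stabilisation, CartanHadamardSwindle, SymplecticCap,
OneHandleSplitting) read: no S²×T²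
host anywhere (only CartanHadamardSwindle's support item CoveringSwindle lists E = S²×ℝ² as an
admissible cover).
Nearest prior art found: McDuff1990 / Wendl2018 Thm D–E and Li1999 (the recognisers, never pointed
at Σ # S²×T²); route Stabilisation
(S²×S² host, smooth cancellation crux); route CartanHadamardSwindle stmt-SmoothPoincare4-8098
(covering swindle for aspherical and
product hosts, curvature recogniser  [refs: 1705.09989, 1904.12350, math/0601320, book:wendlnd-holomorphic-curves-low-dimensions, book:mcduff2017-introduction-symplectic-topology, arxiv:1705.09989, arxiv:1904.12350, arxiv:math/0601320, McDuff1990, Wendl2018, BudneyGabai2019, LaudenbachPoenaru1972]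

Barriers (technique_class: symplectic-rigidity, host-swindle, J-curves): - technique_class: symplectic-rigidity, host-swindle, J-curves
- Literature.Barriers.SmoothPoincare4.GaugeSumBarrierFour: evaded and recycled — no gauge invariant
of Σ or of Σ # S²×T² is evaluated to DISTINGUISH anything; Seiberg–Witten enters only inside Li's
recogniser applied to a GIVEN symplectic P (b⁺ = 1 wall-crossing), and the barrier itself certifies
that nothing known obstructs K1.
- Literature.Barriers.SmoothPoincare4.StableBarrierFour: not engaged — S²×T² is not an
S²×S²-stabilisation and no stable invariant is used; HostAbsorbed is a statement about ONE pinned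
host, not about the stable class.
- Literature.Barriers.SmoothPoincare4.TopologicalBarrierFour: conceded that P is homeomorphic
(indeed homotopy equivalent by construction) to S²×T²; the detecting structure — existence of a
symplectic form, and of one positive on a marked pair — is not a homeomorphism invariant
(knot-surgered vs. honest elliptic surfaces), so the line is outside the class.
- Literature.Barriers.SmoothPoincare4.HCobordismInvariantBarrierFour: same concession (P is
h-cobordant to S²×T²); symplectic existence is not an h-cobordism invariant either.
- Literature.Barriers.SmoothPoincare4.OneStabilisationBarrier: not engaged — no S²×S² summand, no
cork-level uniform stabilisation lemma; Kang's contractible examples concern manifolds with boundary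
and say nothing about HostAbsorbed.
- Literature.Barriers.SmoothPoincare4.GluckTwistCP2Barrier: not engaged — ℂP² appears only as the
bottom rung of the

History (route lifecycle, newest last):
- 2026-08-15T19:40:46Z · rev 1: restated HostPositive (stmt-SmoothPoincare4-14524), CappingRecogniser (stmt-SmoothPoincare4-14525), HostSymplectic (stmt-SmoothPoincare4-14526), PositivityUpgrade (stmt-SmoothPoincare4-14527), RuledRecogniser (stmt-SmoothPoincare4-14528), HostAbsorbed (stmt-SmoothPoincare4-14529), UnitLemma (stmt-SmoothPoincare4 (planner-rrepair-SmoothPoincare4-EllipticRuledH-252192ca-0)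
- 2026-08-16T04:18:20Z · AUTO-CRUX (backfill): HostPositive — hypotheses of the deciding theorem that nothing in the route derives are cruxes (operator:999:1085951)
- 2026-08-22T17:51:18Z · DORMANT — reconciler: no traction for 5.5 d (last activity item-evidence-added at 2026-08-17T04:21:45Z); parked, not closed — `ledger route dormant route-SmoothPoincare4- (operator:999:2480485)

sub-problem: SmoothPoincare4 · status: dormant · opened planner-plancard-SmoothPoincare4-SmoothPoinca-fd810d27-0 2026-08-15T19:09:27Z · rev 3 · ledger route-SmoothPoincare4-EllipticRuledHost
GENERATED by the gate from the ledger (D-0016/17). Provers cite these decls: `theorem foo : Summit.SmoothPoincare4.SmoothPoincare4.Theses.EllipticRuledHost.<Decl> := …` in Summits/SmoothPoincare4/SmoothPoincare4/Theorems/<Name>.lean.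
-/

namespace Summit.SmoothPoincare4.SmoothPoincare4.Theses.EllipticRuledHost

open scoped BigOperators Topology Manifold Classical MeasureTheory ProbabilityTheory Matrix InnerProductSpace ComplexConjugate ContinuousMap
open Filter Set Function TopologicalSpace MeasureTheory

attribute [summit_statement] _root_.SmoothPoincare4

open Literature.SPC4

-- earlier HostPositive (stmt-SmoothPoincare4-14524, replaced 2026-08-15T19:40:46Z -> stmt-SmoothPoincare4-13709): retired by None — ∀ S : Literature.Topology.FourManifolds.HomotopySphere 4, ∃ (P : Type) (_ : TopologicalSpace P) (_ : T2Space P) (_ : SecondCountableTopology P) (_ : ChartedSpace (EuclideanSpace ℝ (Fin 4)) P) (_ : IsManifold (𝓡 4) (⊤ : ℕ∞) P) (_ : CompactSpace P) (i₁ : EuclideanSpace ℝ 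
/-- item stmt-SmoothPoincare4-13709 · crux (kind.auto-crux: conjecture-grade) · rank 0 · open · by planner
why it might fail: X ⟺ SPC4 given CappingRecogniser (S⁴ itself: P = S²×T² with the product form), so X is false iff an exotic 4-sphere exists; constructively it inherits K1's missing engine AND K2's dual-torus unknotting problem.
sources: McDuff1990, Wendl2018, LaudenbachPoenaru1972, Li1999, GompfStipsicz1999
[target] X: for every smooth homotopy 4-sphere Σ (Σ = a smooth homotopy 4-sphere in the Statement's
own binders: M : Type, Hausdorff, second countable, charted on 𝔼⁴, IsManifold (𝓡 4) ∞, with e : M ≃ₕ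
𝕊⁴ (compactness — Hatcher 3.29, tree theorem `compactSpace_of_homotopyEquiv_sphere_four_holds` — and
orientability are consequences, not hypotheses; rev 1 cone repair: no `HomotopySphere` packaging))
some closed connected sum P = Σ # (𝕊²×(𝕊¹×𝕊¹)), given with its gluing data (i₁, i₂, jA, jB) and base
points s₀, t₀ off the disc centre, carries a symplectic form for which the summand's fibre sphere
jB(𝕊²×{t₀}) and section torus jB({s₀}×𝕋²) are symplectic surfaces, sf-orthogonal at their crossing
(card K1 ∧ K2). -/
@[route_item "route-SmoothPoincare4-EllipticRuledHost", crux]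
def HostPositive : Prop :=
  ∀ (M : Type) [TopologicalSpace M] [T2Space M] [SecondCountableTopology M] [ChartedSpace (EuclideanSpace ℝ (Fin 4)) M] [IsManifold (𝓡 4) (⊤ : ℕ∞) M], ContinuousMap.HomotopyEquiv M (Metric.sphere (0 : EuclideanSpace ℝ (Fin 5)) 1) → ∃ (P : Type) (_ : TopologicalSpace P) (_ : T2Space P) (_ : SecondCountableTopology P) (_ : ChartedSpace (EuclideanSpace ℝ (Fin 4)) P) (_ : IsManifold (𝓡 4) (⊤ : ℕ∞) P) (_ : CompactSpace P) (i₁ : EuclideanSpace ℝ (Fin 4) → M) (i₂ : EuclideanSpace ℝ (Fin 4) → (↥(Metric.sphere (0 : EuclideanSpace ℝ (Fin 3)) 1) × (↥(Metric.sphere (0 : EuclideanSpace ℝ (Fin 2)) 1) × ↥(Metric.sphere (0 : EuclideanSpace ℝ (Fin 2)) 1)))) (jA : ↥(Literature.Topology.FourManifolds.puncture i₁) → P) (jB : ↥(Literature.Topology.FourManifolds.puncture i₂) → P) (s₀ : ↥(Metric.sphere (0 : EuclideanSpace ℝ (Fin 3)) 1)) (t₀ : (↥(Metric.sphere (0 :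 EuclideanSpace ℝ (Fin 2)) 1) × ↥(Metric.sphere (0 : EuclideanSpace ℝ (Fin 2)) 1))) (hF : ∀ s : ↥(Metric.sphere (0 : EuclideanSpace ℝ (Fin 3)) 1), (s, t₀) ∈ Literature.Topology.FourManifolds.puncture i₂) (hT : ∀ t : (↥(Metric.sphere (0 : EuclideanSpace ℝ (Fin 2)) 1) × ↥(Metric.sphere (0 : EuclideanSpace ℝ (Fin 2)) 1)), (s₀, t) ∈ Literature.Topology.FourManifolds.puncture i₂) (sf : Literature.Geometry.Kaehler.MForm (𝓡 4) P ℝ 2), Manifold.IsSmoothEmbedding 𝓘(ℝ, EuclideanSpace ℝ (Fin 4)) (𝓡 4) (⊤ : ℕ∞) i₁ ∧ Manifold.IsSmoothEmbedding 𝓘(ℝ, EuclideanSpace ℝ (Fin 4)) ((𝓡 2).prod ((𝓡 1).prod (𝓡 1))) (⊤ : ℕ∞) i₂ ∧ Manifold.IsSmoothEmbedding (𝓡 4) (𝓡 4) (⊤ : ℕ∞) jA ∧ IsOpen (Set.range jA) ∧ Manifold.IsSmoothEmbedding ((𝓡 2).prod ((𝓡 1).prod (𝓡 1))) (𝓡 4)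 (⊤ : ℕ∞) jB ∧ IsOpen (Set.range jB) ∧ Set.range jA ∪ Set.range jB = Set.univ ∧ (∀ a b, jA a = jB b ↔ Literature.Topology.FourManifolds.connectedSumRel i₁ i₂ a b) ∧ Literature.Geometry.Kaehler.IsSmoothForm sf ∧ Literature.Geometry.Kaehler.IsClosedForm sf ∧ (∀ (x : P) (v : TangentSpace (𝓡 4) x), v ≠ 0 → ∃ w : TangentSpace (𝓡 4) x, sf x ![v, w] ≠ 0) ∧ (∀ s : ↥(Metric.sphere (0 : EuclideanSpace ℝ (Fin 3)) 1), ∃ a b : TangentSpace (𝓡 2) s, sf (jB ⟨(s, t₀), hF s⟩) ![mfderiv (𝓡 2) (𝓡 4) (fun s' : ↥(Metric.sphere (0 : EuclideanSpace ℝ (Fin 3)) 1) => jB ⟨(s', t₀), hF s'⟩) s a, mfderiv (𝓡 2) (𝓡 4) (fun s' : ↥(Metric.sphere (0 : EuclideanSpace ℝ (Fin 3)) 1) => jB ⟨(s', t₀), hF s'⟩) s b] ≠ 0) ∧ (∀ t : (↥(Metric.sphere (0 : EuclideanSpace ℝ (Fin 2)) 1) × ↥(Metric.sphere (0 : EuclideanSpace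 ℝ (Fin 2)) 1)), ∃ a b : TangentSpace ((𝓡 1).prod (𝓡 1)) t, sf (jB ⟨(s₀, t), hT t⟩) ![mfderiv ((𝓡 1).prod (𝓡 1)) (𝓡 4) (fun t' : (↥(Metric.sphere (0 : EuclideanSpace ℝ (Fin 2)) 1) × ↥(Metric.sphere (0 : EuclideanSpace ℝ (Fin 2)) 1)) => jB ⟨(s₀, t'), hT t'⟩) t a, mfderiv ((𝓡 1).prod (𝓡 1)) (𝓡 4) (fun t' : (↥(Metric.sphere (0 : EuclideanSpace ℝ (Fin 2)) 1) × ↥(Metric.sphere (0 : EuclideanSpace ℝ (Fin 2)) 1)) => jB ⟨(s₀, t'), hT t'⟩) t b] ≠ 0) ∧ (∀ (a : TangentSpace (𝓡 2) s₀) (b : TangentSpace ((𝓡 1).prod (𝓡 1)) t₀), sf (jB ⟨(s₀, t₀), hF s₀⟩) ![mfderiv (𝓡 2) (𝓡 4) (fun s' : ↥(Metric.sphere (0 : EuclideanSpace ℝ (Fin 3)) 1) => jB ⟨(s', t₀), hF s'⟩) s₀ a, mfderiv ((𝓡 1).prod (𝓡 1)) (𝓡 4) (fun t' : (↥(Metric.sphere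 (0 : EuclideanSpace ℝ (Fin 2)) 1) × ↥(Metric.sphere (0 : EuclideanSpace ℝ (Fin 2)) 1)) => jB ⟨(s₀, t'), hT t'⟩) t₀ b] = 0)

-- earlier CappingRecogniser (stmt-SmoothPoincare4-14525, replaced 2026-08-15T19:40:46Z -> stmt-SmoothPoincare4-13710): retired by None — ∀ S : Literature.Topology.FourManifolds.HomotopySphere 4, (∃ (P : Type) (_ : TopologicalSpace P) (_ : T2Space P) (_ : SecondCountableTopology P) (_ : ChartedSpace (EuclideanSpace ℝ (Fin 4)) P) (_ : IsManifold (𝓡 4) (⊤ : ℕ∞) P) (_ : CompactSpace P) (i₁ : EuclideanSp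
/-- item stmt-SmoothPoincare4-13710 · crux · rank 2 · open · by planner
why it might fail: True at theorem level but unprinted as stated: needs one tame J with BOTH surfaces holomorphic (hence the orthogonal crossing), no bubbling in class F, automatic transversality, trivial bundle from the even form, D²×T₀ complement for every section degree, then LP; Lean has no J-curves at all (XL).
sources: McDuff1990, Wendl2018, McDuffSalamon2017, LaudenbachPoenaru1972, McDuff1991LocalBehaviour
[crux] CAPPING RECOGNISER (card P2, the named-fact-level step the deciding theorem consumes, filed
first per the cone rule): for Σ = (M, e : M ≃ₕ 𝕊⁴) in the Statement's binders, if a closed P = Σ # H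
with gluing data as in X carries a symplectic form making jB(F), jB(T) symplectic and sf-orthogonal
at the crossing, then Σ ≅ 𝕊⁴. Proof in print-sized steps: one sf-tame J makes both surfaces
J-holomorphic; π₂(P) = ℤ·[F] forbids bubbling in class [F] for EVERY tame J, so automatic
transversality + positivity of intersections foliate P by embedded J-spheres with jB(F) a leaf
(McDuff1990; Wendl2018 Thm D(1), §1.3.2); the J-torus meets each leaf once, so it is a section and
the base is T²; even intersection form ⇒ trivial bundle; the complement of ν(fibre ∪ any section) in
S²×T² is a D²-bundle over T₀ = T² ∖ D², i.e. D²×T₀ = ♮2(S¹×B³), while in P it is (D²×T₀) # Σ; so (♮2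
S¹×B³) # Σ ≅ ♮2(S¹×B³), and since every diffeomorphism of #2(S¹×S²) extends over ♮2(S¹×B³)
(Laudenbach–Poénaru), Σ = ((♮2 S¹×B³) # Σ) ∪ ♮2(S²×D²) ≅ S⁴. [difficulty: XL] -/
@[route_item "route-SmoothPoincare4-EllipticRuledHost", crux]
def CappingRecogniser : Prop :=
  ∀ (M : Type) [TopologicalSpace M] [T2Space M] [SecondCountableTopology M] [ChartedSpace (EuclideanSpace ℝ (Fin 4)) M] [IsManifold (𝓡 4) (⊤ : ℕ∞) M], ContinuousMap.HomotopyEquiv M (Metric.sphere (0 : EuclideanSpace ℝ (Fin 5)) 1) → (∃ (P : Type) (_ : TopologicalSpace P) (_ : T2Space P) (_ : SecondCountableTopology P) (_ : ChartedSpace (EuclideanSpace ℝ (Fin 4)) P) (_ : IsManifold (𝓡 4) (⊤ : ℕ∞) P) (_ : CompactSpace P) (i₁ : EuclideanSpace ℝ (Fin 4) → M) (i₂ : EuclideanSpace ℝ (Fin 4) → (↥(Metric.sphere (0 : EuclideanSpace ℝ (Fin 3)) 1) × (↥(Metric.sphere (0 : EuclideanSpace ℝ (Fin 2)) 1) ×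 ↥(Metric.sphere (0 : EuclideanSpace ℝ (Fin 2)) 1)))) (jA : ↥(Literature.Topology.FourManifolds.puncture i₁) → P) (jB : ↥(Literature.Topology.FourManifolds.puncture i₂) → P) (s₀ : ↥(Metric.sphere (0 : EuclideanSpace ℝ (Fin 3)) 1)) (t₀ : (↥(Metric.sphere (0 : EuclideanSpace ℝ (Fin 2)) 1) × ↥(Metric.sphere (0 : EuclideanSpace ℝ (Fin 2)) 1))) (hF : ∀ s : ↥(Metric.sphere (0 : EuclideanSpace ℝ (Fin 3)) 1), (s, t₀) ∈ Literature.Topology.FourManifolds.puncture i₂) (hT : ∀ t : (↥(Metric.sphere (0 : EuclideanSpace ℝ (Fin 2)) 1) × ↥(Metric.sphere (0 : EuclideanSpace ℝ (Fin 2)) 1)), (s₀, t) ∈ Literature.Topology.FourManifolds.puncture i₂) (sf : Literature.Geometry.Kaehler.MForm (𝓡 4) P ℝ 2), Manifold.IsSmoothEmbedding 𝓘(ℝ, EuclideanSpace ℝ (Fin 4)) (𝓡 4) (⊤ : ℕ∞) i₁ ∧ Manifold.IsSmoothEmbedding 𝓘(ℝ, EuclideanSpace ℝ (Fin 4)) ((𝓡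 2).prod ((𝓡 1).prod (𝓡 1))) (⊤ : ℕ∞) i₂ ∧ Manifold.IsSmoothEmbedding (𝓡 4) (𝓡 4) (⊤ : ℕ∞) jA ∧ IsOpen (Set.range jA) ∧ Manifold.IsSmoothEmbedding ((𝓡 2).prod ((𝓡 1).prod (𝓡 1))) (𝓡 4) (⊤ : ℕ∞) jB ∧ IsOpen (Set.range jB) ∧ Set.range jA ∪ Set.range jB = Set.univ ∧ (∀ a b, jA a = jB b ↔ Literature.Topology.FourManifolds.connectedSumRel i₁ i₂ a b) ∧ Literature.Geometry.Kaehler.IsSmoothForm sf ∧ Literature.Geometry.Kaehler.IsClosedForm sf ∧ (∀ (x : P) (v : TangentSpace (𝓡 4) x), v ≠ 0 → ∃ w : TangentSpace (𝓡 4) x, sf x ![v, w] ≠ 0) ∧ (∀ s : ↥(Metric.sphere (0 : EuclideanSpace ℝ (Fin 3)) 1), ∃ a b : TangentSpace (𝓡 2) s, sf (jB ⟨(s, t₀), hF s⟩) ![mfderiv (𝓡 2) (𝓡 4) (fun s' : ↥(Metric.sphere (0 : EuclideanSpace ℝ (Fin 3)) 1) => jB ⟨(s', t₀), hF s'⟩)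 s a, mfderiv (𝓡 2) (𝓡 4) (fun s' : ↥(Metric.sphere (0 : EuclideanSpace ℝ (Fin 3)) 1) => jB ⟨(s', t₀), hF s'⟩) s b] ≠ 0) ∧ (∀ t : (↥(Metric.sphere (0 : EuclideanSpace ℝ (Fin 2)) 1) × ↥(Metric.sphere (0 : EuclideanSpace ℝ (Fin 2)) 1)), ∃ a b : TangentSpace ((𝓡 1).prod (𝓡 1)) t, sf (jB ⟨(s₀, t), hT t⟩) ![mfderiv ((𝓡 1).prod (𝓡 1)) (𝓡 4) (fun t' : (↥(Metric.sphere (0 : EuclideanSpace ℝ (Fin 2)) 1) × ↥(Metric.sphere (0 : EuclideanSpace ℝ (Fin 2)) 1)) => jB ⟨(s₀, t'), hT t'⟩) t a, mfderiv ((𝓡 1).prod (𝓡 1)) (𝓡 4) (fun t' : (↥(Metric.sphere (0 : EuclideanSpace ℝ (Fin 2)) 1) × ↥(Metric.sphere (0 : EuclideanSpace ℝ (Fin 2)) 1)) => jB ⟨(s₀, t'), hT t'⟩) t b] ≠ 0) ∧ (∀ (a : TangentSpace (𝓡 2) s₀) (b : TangentSpace ((𝓡 1).prod (𝓡 1)) t₀),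 sf (jB ⟨(s₀, t₀), hF s₀⟩) ![mfderiv (𝓡 2) (𝓡 4) (fun s' : ↥(Metric.sphere (0 : EuclideanSpace ℝ (Fin 3)) 1) => jB ⟨(s', t₀), hF s'⟩) s₀ a, mfderiv ((𝓡 1).prod (𝓡 1)) (𝓡 4) (fun t' : (↥(Metric.sphere (0 : EuclideanSpace ℝ (Fin 2)) 1) × ↥(Metric.sphere (0 : EuclideanSpace ℝ (Fin 2)) 1)) => jB ⟨(s₀, t'), hT t'⟩) t₀ b] = 0)) → Nonempty (Diffeomorph (𝓡 4) (𝓡 4) M (Metric.sphere (0 : EuclideanSpace ℝ (Fin 5)) 1) (⊤ : ℕ∞))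

-- earlier HostSymplectic (stmt-SmoothPoincare4-14526, replaced 2026-08-15T19:40:46Z -> stmt-SmoothPoincare4-13711): retired by None — ∀ S : Literature.Topology.FourManifolds.HomotopySphere 4, ∃ (P : Type) (_ : TopologicalSpace P) (_ : T2Space P) (_ : SecondCountableTopology P) (_ : ChartedSpace (EuclideanSpace ℝ (Fin 4)) P) (_ : IsManifold (𝓡 4) (⊤ : ℕ∞) P) (_ : CompactSpace P), Literature.Topology.
/-- item stmt-SmoothPoincare4-13711 · crux · rank 3 · open · by planner
why it might fail: No engine makes ω on Σ#(S²×T²) from Σ ≃ S⁴ alone: pencils/BLF simplification need handle data of Σ, near-symplectic forms stop at one odd zero-circle (Perutz2006 Thm 1.4, 1.8: #even ≡ 1−b₁+b⁺ = 0), and ω exists iff S²×T² absorbs Σ, so any non-invertible Σ refutes it.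
sources: Li1999, Taubes1994, Perutz2006, Baykur2008, GompfStipsicz1999, KotschickMorganTaubes1995
[crux] K1 (card K1, the whole bet): for every smooth homotopy 4-sphere Σ (M with e : M ≃ₕ 𝕊⁴, the
Statement's binders; compactness is derived, Hatcher 3.29) some closed connected sum P = Σ #
(𝕊²×(𝕊¹×𝕊¹)) (relational `IsConnectedSum`, P on 𝓡 4) admits a symplectic form — a smooth closed
pointwise-nondegenerate 2-form. Equivalent, given RuledRecogniser, to "S²×T² absorbs Σ"
(HostAbsorbed); implies that Σ is invertible (UnitLemma). [difficulty: open-problem] -/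
@[route_item "route-SmoothPoincare4-EllipticRuledHost"]
def HostSymplectic : Prop :=
  ∀ (M : Type) [TopologicalSpace M] [T2Space M] [SecondCountableTopology M] [ChartedSpace (EuclideanSpace ℝ (Fin 4)) M] [IsManifold (𝓡 4) (⊤ : ℕ∞) M], ContinuousMap.HomotopyEquiv M (Metric.sphere (0 : EuclideanSpace ℝ (Fin 5)) 1) → ∃ (P : Type) (_ : TopologicalSpace P) (_ : T2Space P) (_ : SecondCountableTopology P) (_ : ChartedSpace (EuclideanSpace ℝ (Fin 4)) P) (_ : IsManifold (𝓡 4) (⊤ : ℕ∞) P) (_ : CompactSpace P), Literature.Topology.FourManifolds.IsConnectedSum (𝓡 4) (𝓡 4) ((𝓡 2).prod ((𝓡 1).prod (𝓡 1))) M (↥(Metric.sphere (0 : EuclideanSpace ℝ (Fin 3)) 1) × (↥(Metric.sphere (0 : EuclideanSpace ℝ (Fin 2)) 1) × ↥(Metric.sphere (0 : EuclideanSpace ℝ (Fin 2)) 1))) P ∧ ∃ sf : Literature.Geometry.Kaehler.MForm (𝓡 4) P ℝ 2, Literature.Geometry.Kaehler.IsSmoothForm sf ∧ Literature.Geometry.Kaehler.IsClosedForm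 sf ∧ (∀ (x : P) (v : TangentSpace (𝓡 4) x), v ≠ 0 → ∃ w : TangentSpace (𝓡 4) x, sf x ![v, w] ≠ 0)

-- earlier PositivityUpgrade (stmt-SmoothPoincare4-14527, replaced 2026-08-15T19:40:46Z -> stmt-SmoothPoincare4-13712): retired by None — ∀ S : Literature.Topology.FourManifolds.HomotopySphere 4, (∃ (P : Type) (_ : TopologicalSpace P) (_ : T2Space P) (_ : SecondCountableTopology P) (_ : ChartedSpace (EuclideanSpace ℝ (Fin 4)) P) (_ : IsManifold (𝓡 4) (⊤ : ℕ∞) P) (_ : CompactSpace P), Literature.Topol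
/-- item stmt-SmoothPoincare4-13712 · crux · rank 4 · open · by planner
why it might fail: With P ≅ S²×T² it says the summand pair (F,T) is smoothly standard: unknotting a sphere with only a dual TORUS (complement group F₂, not Freedman-good; LBT needs a COMMON dual sphere, ST arXiv:1904.12350 Rem 1.2) is open even topologically; F#(2-knot) shows complement data matter.
sources: Gabai2020, arXiv:1904.12350, BudneyGabai2019, FreedmanQuinn1990, Gluck1962
[crux] K2 (card K2), per Σ = (M, e : M ≃ₕ 𝕊⁴): if some connected sum Σ # (𝕊²×(𝕊¹×𝕊¹)) admits a
symplectic form, then some connected sum with gluing data admits one for which the summand's fibre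
sphere and section torus are symplectic and sf-orthogonal at the crossing (the body of X for that
Σ). Given K1 and RuledRecogniser, P ≅ S²×T² and K2 asks that the summand pair (jB F, jB T) be
carried to (fibre, section) by a diffeomorphism — a light-bulb statement for a sphere whose only
dual is a TORUS. [deps: HostSymplectic] [difficulty: open-problem] -/
@[route_item "route-SmoothPoincare4-EllipticRuledHost"]
def PositivityUpgrade : Prop :=
  ∀ (M : Type) [TopologicalSpace M] [T2Space M] [SecondCountableTopology M] [ChartedSpace (EuclideanSpace ℝ (Fin 4)) M] [IsManifold (𝓡 4) (⊤ : ℕ∞) M], ContinuousMap.HomotopyEquiv M (Metric.sphere (0 : EuclideanSpace ℝ (Fin 5)) 1) → (∃ (P : Type) (_ : TopologicalSpace P) (_ : T2Space P) (_ : SecondCountableTopology P) (_ : ChartedSpace (EuclideanSpace ℝ (Fin 4)) P) (_ : IsManifold (𝓡 4) (⊤ : ℕ∞) P) (_ : CompactSpace P), Literature.Topology.FourManifolds.IsConnectedSum (𝓡 4) (𝓡 4) ((𝓡 2).prod ((𝓡 1).prod (𝓡 1))) M (↥(Metric.sphere (0 : EuclideanSpace ℝ (Fin 3)) 1) × (↥(Metric.sphere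 (0 : EuclideanSpace ℝ (Fin 2)) 1) × ↥(Metric.sphere (0 : EuclideanSpace ℝ (Fin 2)) 1))) P ∧ ∃ sf : Literature.Geometry.Kaehler.MForm (𝓡 4) P ℝ 2, Literature.Geometry.Kaehler.IsSmoothForm sf ∧ Literature.Geometry.Kaehler.IsClosedForm sf ∧ (∀ (x : P) (v : TangentSpace (𝓡 4) x), v ≠ 0 → ∃ w : TangentSpace (𝓡 4) x, sf x ![v, w] ≠ 0)) → ∃ (P : Type) (_ : TopologicalSpace P) (_ : T2Space P) (_ : SecondCountableTopology P) (_ : ChartedSpace (EuclideanSpace ℝ (Fin 4)) P) (_ : IsManifold (𝓡 4) (⊤ : ℕ∞) P) (_ : CompactSpace P) (i₁ : EuclideanSpace ℝ (Fin 4) → M) (i₂ : EuclideanSpace ℝ (Fin 4) → (↥(Metric.sphere (0 : EuclideanSpace ℝ (Fin 3)) 1) × (↥(Metric.sphere (0 : EuclideanSpace ℝ (Fin 2)) 1) × ↥(Metric.sphere (0 : EuclideanSpace ℝ (Fin 2)) 1)))) (jA : ↥(Literature.Topology.FourManifolds.puncture i₁) → P) (jB : ↥(Literature.Topology.FourManifolds.puncture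 i₂) → P) (s₀ : ↥(Metric.sphere (0 : EuclideanSpace ℝ (Fin 3)) 1)) (t₀ : (↥(Metric.sphere (0 : EuclideanSpace ℝ (Fin 2)) 1) × ↥(Metric.sphere (0 : EuclideanSpace ℝ (Fin 2)) 1))) (hF : ∀ s : ↥(Metric.sphere (0 : EuclideanSpace ℝ (Fin 3)) 1), (s, t₀) ∈ Literature.Topology.FourManifolds.puncture i₂) (hT : ∀ t : (↥(Metric.sphere (0 : EuclideanSpace ℝ (Fin 2)) 1) × ↥(Metric.sphere (0 : EuclideanSpace ℝ (Fin 2)) 1)), (s₀, t) ∈ Literature.Topology.FourManifolds.puncture i₂) (sf : Literature.Geometry.Kaehler.MForm (𝓡 4) P ℝ 2), Manifold.IsSmoothEmbedding 𝓘(ℝ, EuclideanSpace ℝ (Fin 4)) (𝓡 4) (⊤ : ℕ∞) i₁ ∧ Manifold.IsSmoothEmbedding 𝓘(ℝ, EuclideanSpace ℝ (Fin 4)) ((𝓡 2).prod ((𝓡 1).prod (𝓡 1))) (⊤ : ℕ∞) i₂ ∧ Manifold.IsSmoothEmbedding (𝓡 4) (𝓡 4) (⊤ : ℕ∞) jA ∧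 IsOpen (Set.range jA) ∧ Manifold.IsSmoothEmbedding ((𝓡 2).prod ((𝓡 1).prod (𝓡 1))) (𝓡 4) (⊤ : ℕ∞) jB ∧ IsOpen (Set.range jB) ∧ Set.range jA ∪ Set.range jB = Set.univ ∧ (∀ a b, jA a = jB b ↔ Literature.Topology.FourManifolds.connectedSumRel i₁ i₂ a b) ∧ Literature.Geometry.Kaehler.IsSmoothForm sf ∧ Literature.Geometry.Kaehler.IsClosedForm sf ∧ (∀ (x : P) (v : TangentSpace (𝓡 4) x), v ≠ 0 → ∃ w : TangentSpace (𝓡 4) x, sf x ![v, w] ≠ 0) ∧ (∀ s : ↥(Metric.sphere (0 : EuclideanSpace ℝ (Fin 3)) 1), ∃ a b : TangentSpace (𝓡 2) s, sf (jB ⟨(s, t₀), hF s⟩) ![mfderiv (𝓡 2) (𝓡 4) (fun s' : ↥(Metric.sphere (0 : EuclideanSpace ℝ (Fin 3)) 1) => jB ⟨(s', t₀), hF s'⟩) s a, mfderiv (𝓡 2) (𝓡 4) (fun s' : ↥(Metric.sphere (0 : EuclideanSpace ℝ (Fin 3)) 1) => jB ⟨(s', t₀), hF s'⟩) s b] ≠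 0) ∧ (∀ t : (↥(Metric.sphere (0 : EuclideanSpace ℝ (Fin 2)) 1) × ↥(Metric.sphere (0 : EuclideanSpace ℝ (Fin 2)) 1)), ∃ a b : TangentSpace ((𝓡 1).prod (𝓡 1)) t, sf (jB ⟨(s₀, t), hT t⟩) ![mfderiv ((𝓡 1).prod (𝓡 1)) (𝓡 4) (fun t' : (↥(Metric.sphere (0 : EuclideanSpace ℝ (Fin 2)) 1) × ↥(Metric.sphere (0 : EuclideanSpace ℝ (Fin 2)) 1)) => jB ⟨(s₀, t'), hT t'⟩) t a, mfderiv ((𝓡 1).prod (𝓡 1)) (𝓡 4) (fun t' : (↥(Metric.sphere (0 : EuclideanSpace ℝ (Fin 2)) 1) × ↥(Metric.sphere (0 : EuclideanSpace ℝ (Fin 2)) 1)) => jB ⟨(s₀, t'), hT t'⟩) t b] ≠ 0) ∧ (∀ (a : TangentSpace (𝓡 2) s₀) (b : TangentSpace ((𝓡 1).prod (𝓡 1)) t₀), sf (jB ⟨(s₀, t₀), hF s₀⟩) ![mfderiv (𝓡 2) (𝓡 4) (fun s' : ↥(Metric.sphere (0 : EuclideanSpace ℝ (Fin 3)) 1)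 => jB ⟨(s', t₀), hF s'⟩) s₀ a, mfderiv ((𝓡 1).prod (𝓡 1)) (𝓡 4) (fun t' : (↥(Metric.sphere (0 : EuclideanSpace ℝ (Fin 2)) 1) × ↥(Metric.sphere (0 : EuclideanSpace ℝ (Fin 2)) 1)) => jB ⟨(s₀, t'), hT t'⟩) t₀ b] = 0)

-- earlier RuledRecogniser (stmt-SmoothPoincare4-14528, replaced 2026-08-15T19:40:46Z -> stmt-SmoothPoincare4-13713): retired by None — ∀ (S : Literature.Topology.FourManifolds.HomotopySphere 4) (P : Type) [TopologicalSpace P] [T2Space P] [SecondCountableTopology P] [ChartedSpace (EuclideanSpace ℝ (Fin 4)) P] [IsManifold (𝓡 4) (⊤ : ℕ∞) P] [CompactSpace P], Literature.Topology.FourManifolds.IsConnecte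
/-- item stmt-SmoothPoincare4-13713 · crux · rank 5 · open · by planner
why it might fail: Rests on Li1999 Thm 1 (smoothly embedded ESSENTIAL sphere, square ≥ 0 ⇒ rational/ruled), text unread (acq-03619): if only S·S > 0 were covered the square-0, b⁺ = 1 case must be re-derived from LiLiu1995/McDuff1990; the diffeo-type step needs the even form of P (Σ° is a homology ball).
sources: Li1999, LiLiu1995, McDuff1990, Wendl2018
[crux] LI–McDUFF RECOGNISER specialised to the host (card P1, first half; a named fact not yet in
Literature, hence a crux): every CLOSED connected sum P = Σ # (𝕊²×(𝕊¹×𝕊¹)) of a smooth homotopy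
4-sphere Σ = (M, e : M ≃ₕ 𝕊⁴) that admits a symplectic form is diffeomorphic to 𝕊²×(𝕊¹×𝕊¹). Reason:
P contains the smoothly embedded sphere jB(F) with trivial normal bundle and a dual torus, hence
essential of square 0; b₂(P) = 2, σ = 0, b⁺ = 1; Li 1999 Thm 1 (via Li–Liu's b⁺ = 1 wall-crossing /
McDuff) makes (P, ω) rational or ruled up to diffeomorphism, and π₁ = ℤ², b₂ = 2, even form single
out the trivial S²-bundle over T². [difficulty: XL] -/
@[route_item "route-SmoothPoincare4-EllipticRuledHost"]
def RuledRecogniser : Prop :=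
  ∀ (M : Type) [TopologicalSpace M] [T2Space M] [SecondCountableTopology M] [ChartedSpace (EuclideanSpace ℝ (Fin 4)) M] [IsManifold (𝓡 4) (⊤ : ℕ∞) M] (P : Type) [TopologicalSpace P] [T2Space P] [SecondCountableTopology P] [ChartedSpace (EuclideanSpace ℝ (Fin 4)) P] [IsManifold (𝓡 4) (⊤ : ℕ∞) P] [CompactSpace P], ContinuousMap.HomotopyEquiv M (Metric.sphere (0 : EuclideanSpace ℝ (Fin 5)) 1) → Literature.Topology.FourManifolds.IsConnectedSum (𝓡 4) (𝓡 4) ((𝓡 2).prod ((𝓡 1).prod (𝓡 1))) M (↥(Metric.sphere (0 : EuclideanSpace ℝ (Fin 3)) 1) × (↥(Metric.sphere (0 : EuclideanSpace ℝ (Fin 2)) 1) × ↥(Metric.sphere (0 : EuclideanSpace ℝ (Fin 2)) 1))) P → ∀ sf : Literature.Geometry.Kaehler.MForm (𝓡 4) P ℝ 2, Literature.Geometry.Kaehler.IsSmoothForm sf → Literature.Geometry.Kaehler.IsClosedForm sf → (∀ (x : P) (v : TangentSpace (𝓡 4) x), v ≠ 0 → ∃ w : TangentSpace (𝓡 4)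 x, sf x ![v, w] ≠ 0) → Nonempty (Diffeomorph (𝓡 4) ((𝓡 2).prod ((𝓡 1).prod (𝓡 1))) P (↥(Metric.sphere (0 : EuclideanSpace ℝ (Fin 3)) 1) × (↥(Metric.sphere (0 : EuclideanSpace ℝ (Fin 2)) 1) × ↥(Metric.sphere (0 : EuclideanSpace ℝ (Fin 2)) 1))) (⊤ : ℕ∞))

-- earlier HostAbsorbed (stmt-SmoothPoincare4-14529, replaced 2026-08-15T19:40:46Z -> stmt-SmoothPoincare4-13714): retired by None — ∀ S : Literature.Topology.FourManifolds.HomotopySphere 4, ∃ (P : Type) (_ : TopologicalSpace P) (_ : T2Space P) (_ : SecondCountableTopology P) (_ : ChartedSpace (EuclideanSpace ℝ (Fin 4)) P) (_ : IsManifold (𝓡 4) (⊤ : ℕ∞) P) (_ : CompactSpace P), Literature.Topology.Fo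
/-- item stmt-SmoothPoincare4-13714 · support · rank 9 · open · by planner
sources: Li1999, Wall1964, Kang2022OneStabilization, Gluck1962
[support] S²×T² ABSORBS EVERY HOMOTOPY 4-SPHERE: for every smooth homotopy 4-sphere Σ = (M, e : M ≃ₕ
𝕊⁴) some closed connected sum P = Σ # (𝕊²×(𝕊¹×𝕊¹)) is diffeomorphic to 𝕊²×(𝕊¹×𝕊¹). The smooth
content of K1 (= HostSymplectic ∧ RuledRecogniser, item AbsorbedOfSymplectic; conversely pull back
the product form); strictly between SPC4 and invertibility; incomparable, as far as searched, with
StabOneSuffices of route Stabilisation (S²×S² host). Other doors: P fibres over S¹ (a nowhere-zero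
closed 1-form; fibre has π₁ = ℤ hence is S²×S¹, monodromy forced by the even form), or P admits a
complex structure (b₁ even ⇒ Kähler). [difficulty: open-problem] -/
@[route_item "route-SmoothPoincare4-EllipticRuledHost"]
def HostAbsorbed : Prop :=
  ∀ (M : Type) [TopologicalSpace M] [T2Space M] [SecondCountableTopology M] [ChartedSpace (EuclideanSpace ℝ (Fin 4)) M] [IsManifold (𝓡 4) (⊤ : ℕ∞) M], ContinuousMap.HomotopyEquiv M (Metric.sphere (0 : EuclideanSpace ℝ (Fin 5)) 1) → ∃ (P : Type) (_ : TopologicalSpace P) (_ : T2Space P) (_ : SecondCountableTopology P) (_ : ChartedSpace (EuclideanSpace ℝ (Fin 4)) P) (_ : IsManifold (𝓡 4) (⊤ : ℕ∞) P) (_ : CompactSpace P), Literature.Topology.FourManifolds.IsConnectedSum (𝓡 4) (𝓡 4) ((𝓡 2).prod ((𝓡 1).prod (𝓡 1))) M (↥(Metric.sphere (0 : EuclideanSpace ℝ (Fin 3)) 1) × (↥(Metric.sphere (0 : EuclideanSpace ℝ (Fin 2)) 1) × ↥(Metric.sphere (0 : EuclideanSpace ℝ (Fin 2)) 1))) P ∧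 Nonempty (Diffeomorph (𝓡 4) ((𝓡 2).prod ((𝓡 1).prod (𝓡 1))) P (↥(Metric.sphere (0 : EuclideanSpace ℝ (Fin 3)) 1) × (↥(Metric.sphere (0 : EuclideanSpace ℝ (Fin 2)) 1) × ↥(Metric.sphere (0 : EuclideanSpace ℝ (Fin 2)) 1))) (⊤ : ℕ∞))

-- earlier UnitLemma (stmt-SmoothPoincare4-14531, replaced 2026-08-15T19:40:46Z -> stmt-SmoothPoincare4-13715): retired by None — (∀ (S : Literature.Topology.FourManifolds.HomotopySphere 4) (p : S.carrier), SimplyConnectedSpace ({p}ᶜ : Set S.carrier)) → (∀ S : Literature.Topology.FourManifolds.HomotopySphere 4, (∃ (p : S.carrier) (f : (⟨{p}ᶜ, isOpen_compl_singleton⟩ : TopologicalSpace.Opens S.carrier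
/-- item stmt-SmoothPoincare4-13715 · support · rank 9 · open · by planner
sources: Hatcher2002, Mazur1959, KervaireMilnor1963
[support] THE COVERING SWINDLE FOR THE RULED HOST (card P1, second half): granted the two known
facts carried as its first hypotheses, both stated over the Statement's binders (M, e : M ≃ₕ 𝕊⁴) —
every punctured smooth homotopy 4-sphere is simply connected (π₁(S⁴) = 1, tree
`simplyConnectedSpace_sphere_four_holds`, plus removing a point from a 4-manifold; the content of
support item stmt-SmoothPoincare4-8099 of CartanHadamardSwindle) and puncture homogeneity (one
punctured embedding in ℝ⁴ gives one at every point; the content of stmt-SmoothPoincare4-8100, the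
tree's disc-theorem family) — if S²×T² absorbs every homotopy 4-sphere (HostAbsorbed) then every
punctured homotopy 4-sphere smoothly embeds in ℝ⁴; the conclusion is crux (A)
`SchsplitPuncturedEmbeds` of route SchoenfliesSplit up to the Σ-packaging (so K1 feeds that route's
frame (A) ∧ Schoenflies → SPC4). Proof: the universal cover of 𝕊²×(𝕊¹×𝕊¹) is the open subset E = ℝ⁴
∖ {x₀ = x₁ = x₂ = 0} ≅ S²×ℝ² of ℝ⁴ with the explicit smooth covering x ↦ (x'/‖x'‖, (cos log‖x'‖, sin
log‖x'‖), (cos x₃, sin x₃)), x' = (x₀,x₁,x₂); compose with the diffeomorphism P ≅ H; the punctured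
summand Σ ∖ {i₁ 0} is an open, simply connected (hypothesis) -/
@[route_item "route-SmoothPoincare4-EllipticRuledHost"]
def UnitLemma : Prop :=
  (∀ (M : Type) [TopologicalSpace M] [T2Space M] [SecondCountableTopology M] [ChartedSpace (EuclideanSpace ℝ (Fin 4)) M] [IsManifold (𝓡 4) (⊤ : ℕ∞) M], ContinuousMap.HomotopyEquiv M (Metric.sphere (0 : EuclideanSpace ℝ (Fin 5)) 1) → ∀ p : M, SimplyConnectedSpace (({p}ᶜ : Set M))) → (∀ (M : Type) [TopologicalSpace M] [T2Space M] [SecondCountableTopology M] [ChartedSpace (EuclideanSpace ℝ (Fin 4)) M] [IsManifold (𝓡 4) (⊤ : ℕ∞) M], ContinuousMap.HomotopyEquiv M (Metric.sphere (0 : EuclideanSpace ℝ (Fin 5)) 1) → (∃ (p : M) (f : (⟨{p}ᶜ, isOpen_compl_singleton⟩ : TopologicalSpace.Opens M) → EuclideanSpace ℝ (Fin 4)), Manifold.IsSmoothEmbedding (𝓡 4) (𝓡 4) (⊤ : ℕ∞) f) → ∀ p : M, ∃ f : (⟨{p}ᶜ, isOpen_compl_singleton⟩ : TopologicalSpace.Opens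 M) → EuclideanSpace ℝ (Fin 4), Manifold.IsSmoothEmbedding (𝓡 4) (𝓡 4) (⊤ : ℕ∞) f) → HostAbsorbed → ∀ (M : Type) [TopologicalSpace M] [T2Space M] [SecondCountableTopology M] [ChartedSpace (EuclideanSpace ℝ (Fin 4)) M] [IsManifold (𝓡 4) (⊤ : ℕ∞) M], ContinuousMap.HomotopyEquiv M (Metric.sphere (0 : EuclideanSpace ℝ (Fin 5)) 1) → ∀ p : M, ∃ f : (⟨{p}ᶜ, isOpen_compl_singleton⟩ : TopologicalSpace.Opens M) → EuclideanSpace ℝ (Fin 4), Manifold.IsSmoothEmbedding (𝓡 4) (𝓡 4) (⊤ : ℕ∞) f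

/-- item stmt-SmoothPoincare4-14530 · support · rank 9 · open · by planner
sources: Li1999, McDuff1990
[support] K1 and the recogniser give absorption: HostSymplectic → RuledRecogniser → HostAbsorbed
(pure logic; compiled in the planner's Sketch.lean). [difficulty: provable-now] -/
@[route_item "route-SmoothPoincare4-EllipticRuledHost"]
def AbsorbedOfSymplectic : Prop :=
  HostSymplectic → RuledRecogniser → HostAbsorbed

/-- item stmt-SmoothPoincare4-14532 · support · rank 9 · open · by planner
sources: McDuff1990
[support] the card's split of X: HostSymplectic → PositivityUpgrade → HostPositive (pure logic, `fun
h₁ h₂ S => h₂ S (h₁ S)`, compiled in Sketch.lean). [difficulty: provable-now] -/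
@[route_item "route-SmoothPoincare4-EllipticRuledHost"]
def TargetSplit : Prop :=
  HostSymplectic → PositivityUpgrade → HostPositive

/-- item stmt-SmoothPoincare4-14533 · assembly · rank 1 · open · by planner
sources: McDuff1990, LaudenbachPoenaru1972, KervaireMilnor1963
[assembly] HostPositive → CappingRecogniser → SmoothPoincare4 (= the deciding theorem `closes`). -/
@[route_item "route-SmoothPoincare4-EllipticRuledHost"]
def Assembly : Prop :=
  HostPositive → CappingRecogniser → SmoothPoincare4

/-! D-0027 §2.1 — DECIDING THEOREM (planner-authored via `route open/edit --closes-file`; by planner-rrepair-SmoothPoincare4-EllipticRuledH-252192ca-0 2026-08-15T19:40:46Z):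
its hypotheses are this route's items and its conclusion the sub-problem Statement (glue_lint), and it elaborates with this file. -/

@[closes "route-SmoothPoincare4-EllipticRuledHost"] theorem closes (hX : HostPositive) (hCap : CappingRecogniser) : _root_.SmoothPoincare4 := by
  intro M _ _ _ _ _ e
  exact hCap M e (hX M e)

end Summit.SmoothPoincare4.SmoothPoincare4.Theses.EllipticRuledHost
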